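import Summits.ABC.ABC.Theses.TwistAmplification
import Literature.NumberTheory.CubicFields.MaximalOverring
import Literature.NumberTheory.CubicFields.DeloneFaddeevIndexForm

/-!
# Skeleton line `unit-plane-conic-two-torsion` for crux `SharpModerateLaw` (stmt-ABC-1975)

Route `TwistAmplification`, crux r2 `SharpModerateLaw` =
`∀ 3 < κ < 6 < σ, ε > 0 ∃ C ∀ X ≥ 1: T⁺_[κ,σ](X) ≤ C·X^{1−κ/6+ε}` (reduced minimal integral
models `W₀`, `c₄c₆ ≠ 0`, conductor `N ≤ X`, `N^κ ≤ M⁺ := max(|Δ|,|c₄|³) ≤ N^σ`).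

## The line (idea card `Ideas/unit-plane-conic-two-torsion.md`, crux-ideate r1 ideator 1 — the
declared companion / second engine of `syzygy-lattice-half-deep-few-primes`; triage r1: 3 × pass,
"with doubt"; merge advice: one line, two engines)

COORDINATES.  A reduced minimal model gives `(c₄, c₆) ∈ ℤ²` with `c₄³ − c₆² = 1728Δ`
(`WeierstrassCurve.c_relation`); the element `ξ = t mod (t³ − 3c₄t − 2c₆)` generates the cubic ring
`ℤ[ξ] = R(F₀)`, `F₀ = (1, 0, −3c₄, −2c₆)`, `Disc F₀ = 108(c₄³ − c₆²) = 2⁸3⁶Δ`; its MAXIMAL OVERRING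
`O = R(F)` (`RingOfForm.exists_isMaximal_overring`, unique up to `GL₂(ℤ)`:
`gl2zEquiv_of_isMaximal_overrings`) is the twist-invariant "field" datum (for irreducible `F` it is
`𝓞 ℚ(E[2])`), and `ξ = t₀ + yω + zθ ∈ O` with `(y, z) = g·(u, v)`, `IsCoprime u v`, `g ≥ 1` the
CONTENT (= the quadratic-twist parameter).  VERIFIED IDENTITIES (folder `compute/poly.py`, exact
polynomial arithmetic in the multiplication table `ωθ = −ad, ω² = −ac + bω − aθ, θ² = −bd + dω − cθ`
of `DeloneFaddeevRing`): `Tr(yω + zθ) = by − cz`; the traceless element `3(yω+zθ) − Tr` has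
characteristic polynomial `t³ − 3·H_F(y,z)·t − G_F(y,z)` (`hess`, `cov` below), whence
`c₄ = H_F(y,z)/9`, `c₆ = G_F(y,z)/54`, `2⁸3⁶ Δ = Disc F · F(y,z)²` (syzygy `4H³ − G² = 27·Disc F·F²`,
checked), so `M⁺ = mplusIF F y z` EXACTLY; `c₄ ≠ 0 ⟺ H ≠ 0`, `c₆ ≠ 0 ⟺ G ≠ 0` (triage BUG 1 guard);
minimality ⟹ `g` tower-free (`p² ∤ g` for `p ≥ 5`, `2⁴ ∤ g`, `3⁴ ∤ g`); the conductor is bounded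
BELOW by `Nflat F g u v = ∏_{p ∣ g, p ∤ 6} p² · ∏_{p ∤ 6g, p ∣ Disc F·F(u,v)} p` (a prime of `g`
divides `c₄` and `Δ`, hence is additive — the TWIST TEST of TRIAGE r1-3 is passed by charging `p²`;
every other prime of `Disc F · F(u,v)` is bad).  On the saturated plane `ker(z-coordinate) =
ℤ ⊕ ℤω` the norm form is the index form: `N(a·u + v·ω) = a²·F(u, v)` (checked), and for every
`λ ∈ O` the ternary quadratic form `β ↦ z-coordinate(λβ²)` — the PLANARITY CONIC `Q_λ` — has Gram
determinant `a·N(λ)` (checked).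

THE TWO ENGINES (Kane arXiv:1104.2635 §2–3, transplanted from `A + B + C = 0` in `ℤ³` to "`ξ` lies
in a plane of `O ≅ ℤ³`").  For a datum write `m = F(u,v)`, `m♭` = its part prime to `6·g·Disc F`,
`v(m♭)` = radical of the repeated part (Kane's `v`), `m♭ = T·S²` (`T` the square-free kernel).
(i) LATTICE HALF (`stub_fewDeepPrimes`, = the companion card's `LatticeHalf` summed over rings and
twists): "`e ∣ F(u,v)`" is membership in `≤ 3^{ω(e)}` sublattices of index `e` (Hensel at
`p ∤ 6·Disc F`), Kane's Lemma 4 counts their primitive points in the seed ellipse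
`{M⁺ ≤ Y} ∩ (content g)` of area `≍ Y^{1/3}/(g²|Disc F|^{1/2})`; it proves the law on the FEW-DEEP
population `v(m♭) ≤ w := X·Y^{−1/6}/(g·rad₆ Disc F)` above the Hall floor, the ring/twist sum closing
by `Σ_{F,g} 1/(g·rad Disc F) ≪ X^{o(1)}` (Davenport–Heilbronn + Hasse).
(ii) CONIC HALF (THIS card's lever, `stub_planarityFactorisation` ⟶ `stub_spreadCensus`): on the
SPREAD population `v(m♭) > w` one has `S ≥ v > w`; the ideal `(a u + vω)` of `O` factors as `𝔞·𝔟²`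
with `N𝔟 ⊇ S`, and after fixing class representatives and units modulo squares,
`r²(a u + vω) = λ·β²` with `λ` from a finite SHAPE SET `Λ_T` of size `≤ C_F·|Cl(O)[2]|·3^{ω(T)}` and
`|N λ| ≤ C_F·T`: the datum is a primitive zero of the planarity conic `Q_λ` (`det = a·Nλ ≍ T`) in
a box of side-product `≍ S` — Kane's Prop. 9 with `(S, T) ↦ (S, T)` inside an arbitrary maximal
cubic ring, the only new multiplicity `|Cl(O)[2]|` having bounded mean over cubic fields
(Bhargava, Ann. Math. 162 (2005) Thm 5).  What is LEFT is the CENSUS (`stub_spreadCensus`, OPEN,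
HARDEST): jointly over rings `F`, twists `g`, cells `(T, S)` and root classes `r = (u:v) mod T`,
few planarity conics carry an admissible zero — with one more averaging variable (the cubic form
`(a,b,c,d)` of `O`) than any census previously proposed for abc counts.
(iii) The HALL / bad-prime CORNER `m♭ < X^{−ε/4}·m_max` (`stub_cornerLaw`, OPEN) is the common hard
corner of all seven r1 cards (TRIAGE r1-2 "one hard corner, five names"); neither engine's main
term survives there; it is isolated, not attacked, by this line.

`SharpModerateLaw_of` composes the six stubs into the crux BY NAME (kernel-checked, no `sorry`):
few-deep ∪ spread ∪ corner = all data (`indexFormLaw_univ_of_cover`, proved here), then the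
dictionary (`stub_indexFormDictionary`) and the transfer (`stub_cuspTransfer`).

## Corrections to the card recorded by this plan (details in `Lines/unit-plane-conic-two-torsion.md`)
* Heath-Brown's 1997 conic bound (exponent `1/2`, Kane Thm 7) is NOT enough even for a true census:
  in the cells `T ≍ 1`, `S ≍ m^{1/2}` a hit class costs `(S/T)^{1/2} = R^{3/4}` against `≍ R^{1/2}`
  genuine conic points; the SHARP bound with exponent `1/3` (Heath-Brown 2002 Cor. 2 / Browning;
  in tree for DIAGONAL forms: `SquarefulDet.fiberBound`) is mandatory, and the census must be JOINT
  over `(F, g, T, r)`, not per ring.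
* The unconditional "Kane milestone" is not `X^{κ/6+ε}`: the per-ring parasitic term `≍ R_F` summed
  over the `≍ Y^{2/3}` maximal rings that can carry a datum of height `Y^{1/6}` gives `≍ Y^{2/3}`
  (trivial: `Y^{5/6}`); Kane's `N^{1+ε}` transports only slice by slice.

## Disproof used (cdisprove `Disproof.lean` v6, 2026-08-15T23:12Z, ~2170 lines rc 0 — known here
through its six evidence notes only: `run/gate/evidence/**` is not mounted in planner jails and
`ledger crux cat stmt-ABC-1975 Disproof.lean` has no workfile)
* `not_sharpModerateLaw_without_c4` / `_without_c6` (sextic / quartic twist families, BUG 1) —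
  HONOURED at `stub_cuspTransfer` (`cuspWin` keeps `x.1 ≠ 0 ∧ x.2 ≠ 0`) and at
  `stub_indexFormDictionary` (`ifWin` keeps `hess ≠ 0 ∧ cov ≠ 0`): "the line uses `c₄c₆ ≠ 0` at the
  transfer and the dictionary".
* `not_sharpModerateLaw_without_minimality` (non-minimal scalings `k ≤ b²`) — HONOURED: `TF` in
  `cuspWin`, tower-free content `g` in `ifWin` (a scaling by `k` multiplies `g` by `k²`); without it
  the index-form law is false by the factor `Y^{1/6}` (scalings of all seeds), checked on paper.
* `not_sharpModerateLawWithoutKappaLtSix`, `sharpModerateLaw_iff_anySigma`,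
  `not_sharpModerateLaw_without_eps_pos` — HONOURED at `stub_cuspTransfer`: `κ < 6` is what makes
  the dyadic sum `Σ_{Y ≤ X^κ} Y^{1/κ−1/6}` geometric with top term `X^{1−κ/6}`; every law keeps
  `X^{+ε}`; `σ` enters only through `Y ≤ X^σ`.
* `not_sharpModerateLaw_lowered`, `window_not_power_saving` (tightness along `κ ↑ 12j/(2j+1)`) —
  consistent: no stub claims an exponent below `1 − κ/6`, i.e. below `X·Y^{−1/6}` at `Y = X^κ`.
* `sharpModerateLaw_without_reduced_trivial` — the reducedness clauses are used once, in
  `stub_cuspTransfer` (≤ 12 reduced models per `(c₄, c₆)`).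
* No `Negative/` lemma has landed for this crux (gate refuses refuter landings there; nothing to
  import); `ledger negatives --problem ABC` = stmt-ABC-1689, stmt-ABC-1205, unrelated to counting —
  no stub is an instance of either.  Every typed transfer of round 1 that the triage refuted
  (`CuspCountLaw` cumulative in `Y`, `IndexFormCensus` without `HG ≠ 0`, `BoxRadicalLaw` with a
  radical instead of a conductor) is avoided here by construction: dyadic `M⁺`, `hess·cov ≠ 0`,
  `Nflat` charging `p²` at content primes.
-/

noncomputable section

set_option linter.dupNamespace false

open scoped BigOperators
open Finset
open Literature.NumberTheory.CubicFields
open Literature.NumberTheory.CubicFields.BinaryCubic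
open Literature.NumberTheory.CubicFields.RingOfForm

namespace Summit.ABC.ABC.Cruxes.SharpModerateLaw.UnitPlaneConicTwoTorsion

/-! ### Level 1 — the `(c₄, c₆)` cusp law C⁺ (ideator 2's `cuspSet` law, made DYADIC in `M⁺` as all
three triagers require; `TF`, `Nstar` verbatim from `Ideator2Sketch.lean`) -/

/-- Tower-freeness of `(c₄, c₆)`: the divisibility pattern a model minimal at every prime cannot
have (`p ≥ 5`: `p⁴ ∣ c₄ ∧ p⁶ ∣ c₆`; at `2`: `2⁸ ∣ c₄ ∧ 2¹¹ ∣ c₆`; at `3`: `3⁵ ∣ c₄ ∧ 3⁹ ∣ c₆`). -/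
def TF (x : ℤ × ℤ) : Prop :=
  (∀ p : ℕ, p.Prime → 5 ≤ p → ¬ ((p : ℤ) ^ 4 ∣ x.1 ∧ (p : ℤ) ^ 6 ∣ x.2)) ∧
  ¬ ((2 : ℤ) ^ 8 ∣ x.1 ∧ (2 : ℤ) ^ 11 ∣ x.2) ∧ ¬ ((3 : ℤ) ^ 5 ∣ x.1 ∧ (3 : ℤ) ^ 9 ∣ x.2)

/-- Conductor proxy `N*(c₄, c₆) = ∏_{p ∣ Δ} (p² if p ∣ c₄ else p)`, `Δ = (c₄³ − c₆²)/1728`; for a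
minimal model `N* ≤ N` (Silverman AEC VII.5.1: `p ∣ Δ, p ∤ c₄` multiplicative, `f_p = 1`;
`p ∣ Δ, p ∣ c₄` additive, `f_p ≥ 2`; tree: `conductorExponent_eq_one_of_dvd_Δ_of_not_dvd_c₄`). -/
def Nstar (x : ℤ × ℤ) : ℕ :=
  ∏ p ∈ ((x.1 ^ 3 - x.2 ^ 2) / 1728).natAbs.primeFactors, (if ((p : ℕ) : ℤ) ∣ x.1 then p ^ 2 else p)

/-- `M⁺(c₄, c₆) = max(|c₄|³, |Δ|)` with `Δ = (c₄³ − c₆²)/1728` (exact division on `cuspWin`). -/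
def mplus (x : ℤ × ℤ) : ℤ :=
  max (|x.1| ^ 3) (|x.1 ^ 3 - x.2 ^ 2| / 1728)

/-- The DYADIC cusp window at `(X, Y)`: `(c₄, c₆)` with `c₄c₆ ≠ 0`, `Δ ≠ 0`, `1728 ∣ c₄³ − c₆²`,
tower-free, `M⁺ ∈ (Y/2, Y]` and `N* ≤ X`. -/
def cuspWin (X Y : ℝ) : Set (ℤ × ℤ) :=
  {x | x.1 ≠ 0 ∧ x.2 ≠ 0 ∧ x.1 ^ 3 ≠ x.2 ^ 2 ∧ (1728 : ℤ) ∣ x.1 ^ 3 - x.2 ^ 2 ∧ TF x ∧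
    Y < 2 * ((mplus x : ℤ) : ℝ) ∧ ((mplus x : ℤ) : ℝ) ≤ Y ∧ (Nstar x : ℝ) ≤ X}

/-- **C⁺ = the dyadic cusp-count law** (the two-parameter `(c₄, c₆)` random-model law, conductor by
the proxy `N*`, twist-covariant, `+1` free of pointwise Szpiro content):
`#cuspWin(X, Y) ≤ C(σ, ε) X^ε (X·Y^{−1/6} + 1)` for `1 ≤ Y ≤ X^σ`. -/
def CuspWindowLaw : Prop :=
  ∀ σ ε : ℝ, 0 < ε → ∃ C : ℝ, ∀ X Y : ℝ, 1 ≤ X → 1 ≤ Y → Y ≤ X ^ σ →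
    (Set.ncard (cuspWin X Y) : ℝ) ≤ C * X ^ ε * (X * Y ^ (-(1 / 6 : ℝ)) + 1)

/-! ### Level 2 — index-form coordinates `(F, g, (u, v))` over MAXIMAL cubic rings -/

/-- Integral binary cubic forms `F = (a, b, c, d)` (tree: `BinaryCubic ℤ`, BTT §2.2). -/
abbrev Form : Type := BinaryCubic ℤ

/-- The Hessian covariant `H_F(u,v) = (b²−3ac)u² + (bc−9ad)uv + (c²−3bd)v²`. -/
def hess (F : Form) (u v : ℤ) : ℤ :=
  (F.b ^ 2 - 3 * F.a * F.c) * u ^ 2 + (F.b * F.c - 9 * F.a * F.d) * u * v + (F.c ^ 2 - 3 * F.b * F.d) * v ^ 2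

/-- The cubic covariant `G_F(u,v)` (normalised so that `4 H³ − G² = 27·Disc F·F²`, checked). -/
def cov (F : Form) (u v : ℤ) : ℤ :=
  (2 * F.b ^ 3 - 9 * F.a * F.b * F.c + 27 * F.a ^ 2 * F.d) * u ^ 3
    + 3 * (F.b ^ 2 * F.c + 9 * F.a * F.b * F.d - 6 * F.a * F.c ^ 2) * u ^ 2 * v
    - 3 * (F.b * F.c ^ 2 + 9 * F.a * F.c * F.d - 6 * F.b ^ 2 * F.d) * u * v ^ 2
    - (2 * F.c ^ 3 + 27 * F.a * F.d ^ 2 - 9 * F.b * F.c * F.d) * v ^ 3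

/-- `M⁺` read in index-form coordinates: `max(|H(y,z)|³/3⁶, |Disc F·F(y,z)²|/(2⁸3⁶))` — equal to
`max(|c₄|³, |Δ|)` on curve data (`c₄ = H/9`, `2⁸3⁶Δ = Disc F·F²`). -/
def mplusIF (F : Form) (y z : ℤ) : ℝ :=
  max (((|hess F y z| : ℤ) : ℝ) ^ 3 / 3 ^ 6) (((|F.disc * (F.eval y z) ^ 2| : ℤ) : ℝ) / (2 ^ 8 * 3 ^ 6))

/-- Radical of `n` away from the primes dividing `m`: `∏_{p ∣ n, p ∤ m} p`. -/
def radAway (m n : ℕ) : ℕ := ∏ p ∈ n.primeFactors with ¬ p ∣ m, p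

/-- The part of `n` coprime to `m`: `∏_{p ∣ n, p ∤ m} p^{v_p(n)}`. -/
def coprimePart (m n : ℕ) : ℕ := ∏ p ∈ n.primeFactors with ¬ p ∣ m, p ^ n.factorization p

/-- Kane's repeated radical `v(n) = ∏_{p² ∣ n} p` (`= 1` iff `n` is square-free). -/
def repRad (n : ℕ) : ℕ := ∏ p ∈ n.primeFactors with p ^ 2 ∣ n, p

/-- Square-free kernel `T(n) = ∏_{v_p(n) odd} p` (so `n = T(n)·S(n)²`, Kane's `T`). -/
def sqfreeKernel (n : ℕ) : ℕ := ∏ p ∈ n.primeFactors with ¬ 2 ∣ n.factorization p, p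

/-- Kane's `S(n) = ∏ p^{⌊v_p(n)/2⌋}`, the largest integer whose square divides `n`. -/
def sqPart (n : ℕ) : ℕ := ∏ p ∈ n.primeFactors, p ^ (n.factorization p / 2)

/-- Conductor LOWER bound in index-form coordinates (content primes `p ∤ 6` charged `p²`, every
other prime of `Disc F · F(u,v)` away from `6g` charged `p`; `2, 3` dropped — constants). -/
def Nflat (F : Form) (g : ℕ) (u v : ℤ) : ℕ :=
  (∏ p ∈ g.primeFactors with ¬ p ∣ 6, p ^ 2) * radAway (6 * g) (F.disc * F.eval u v).natAbs

/-- A datum over a ring: content `g` and the primitive coordinates `(u, v)`. -/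
abbrev Datum : Type := ℕ × ℤ × ℤ

/-- The index-form window of the maximal form `F` at scales `(X, Y)`: data `(g, u, v)` with `g ≥ 1`
tower-free (`2⁴ ∤ g`, `3⁴ ∤ g`, `p² ∤ g` for `p ≥ 5`), `(u, v)` coprime, `F(u,v) ≠ 0` (`Δ ≠ 0`),
`H, G ≠ 0` at `g·(u,v)` (`c₄c₆ ≠ 0`), `M⁺ ∈ (Y/2, Y]` and `Nflat ≤ X`.  A superset of the image of
`cuspWin` under the dictionary (integrality of `H/9`, `G/54` is not demanded). -/
def ifWin (F : Form) (X Y : ℝ) : Set Datum :=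
  {d | 0 < d.1 ∧ ¬ 2 ^ 4 ∣ d.1 ∧ ¬ 3 ^ 4 ∣ d.1 ∧ (∀ p : ℕ, p.Prime → 5 ≤ p → ¬ p ^ 2 ∣ d.1) ∧
    IsCoprime d.2.1 d.2.2 ∧ F.eval d.2.1 d.2.2 ≠ 0 ∧
    hess F (d.1 * d.2.1) (d.1 * d.2.2) ≠ 0 ∧ cov F (d.1 * d.2.1) (d.1 * d.2.2) ≠ 0 ∧
    Y < 2 * mplusIF F (d.1 * d.2.1) (d.1 * d.2.2) ∧ mplusIF F (d.1 * d.2.1) (d.1 * d.2.2) ≤ Y ∧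
    (Nflat F d.1 d.2.1 d.2.2 : ℝ) ≤ X}

/-- A REGION is a predicate on `(ε; X, Y; F; datum)` (it may depend on the law's `ε` and scales). -/
abbrev Region : Type := ℝ → ℝ → ℝ → Form → Datum → Prop

/-- **The index-form window law on a region `R`**: for `1 ≤ Y ≤ X^σ` and every finite family `𝓕` of
pairwise `GL₂(ℤ)`-inequivalent nondegenerate MAXIMAL forms, the total number of window data lying
in `R` is `≤ C(σ,ε)·X^ε·(X·Y^{−1/6} + 1)`. (Counting over inequivalent representatives makes the
count independent of the choice of representative: `ifWin` is `GL₂(ℤ)`-covariant.) -/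
def IndexFormLaw (R : Region) : Prop :=
  ∀ σ ε : ℝ, 0 < ε → ∃ C : ℝ, ∀ X Y : ℝ, 1 ≤ X → 1 ≤ Y → Y ≤ X ^ σ →
    ∀ 𝓕 : Finset Form, (∀ F ∈ 𝓕, F.disc ≠ 0 ∧ IsMaximal F) →
      (𝓕 : Set Form).Pairwise (fun F F' => ¬ GL2ZEquiv F F') →
        ∑ F ∈ 𝓕, (Set.ncard {d ∈ ifWin F X Y | R ε X Y F d} : ℝ) ≤
          C * X ^ ε * (X * Y ^ (-(1 / 6 : ℝ)) + 1)

/-- The trivial region. -/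
def univRegion : Region := fun _ _ _ _ _ => True

/-! ### The three populations (Kane's split by the repeated radical, plus the Hall floor) -/

/-- `m♭`: the part of `|F(u,v)|` prime to `6 · g · Disc F` (unramified, non-content primes). -/
def mflat (F : Form) (d : Datum) : ℕ :=
  coprimePart (6 * d.1 * F.disc.natAbs) (F.eval d.2.1 d.2.2).natAbs

/-- `m_max(F, g, Y) = (2⁸3⁶·Y/|Disc F|)^{1/2} / g³` — the largest `|F(u,v)|` a datum of content `g`
at scale `Y` can have (`|Disc F|·g⁶·F(u,v)² = 2⁸3⁶|Δ| ≤ 2⁸3⁶ Y`). -/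
def mMax (F : Form) (g : ℕ) (Y : ℝ) : ℝ :=
  Real.sqrt (2 ^ 8 * 3 ^ 6 * Y / ((F.disc.natAbs : ℕ) : ℝ)) / (g : ℝ) ^ 3

/-- The few-deep cap `w(F, g; X, Y) = X·Y^{−1/6} / (g · rad₆(Disc F))` (the law's share of the pair
`(F, g)`; Kane's "+1 per lattice" is affordable exactly up to `w`, and `w < 1` empties the region). -/
def wCap (F : Form) (g : ℕ) (X Y : ℝ) : ℝ :=
  X * Y ^ (-(1 / 6 : ℝ)) / ((g : ℝ) * (radAway 6 F.disc.natAbs : ℝ))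

/-- FEW-DEEP data: repeated radical `v(m♭) ≤ w` and `m♭` above the Hall floor `X^{−ε/4}·m_max`. -/
def FewDeep : Region := fun ε X Y F d =>
  (repRad (mflat F d) : ℝ) ≤ wCap F d.1 X Y ∧ X ^ (-(ε / 4)) * mMax F d.1 Y ≤ (mflat F d : ℝ)

/-- SPREAD data: repeated radical `v(m♭) > w` (hence square part `S(m♭) > w`), above the floor. -/
def Spread : Region := fun ε X Y F d =>
  wCap F d.1 X Y < (repRad (mflat F d) : ℝ) ∧ X ^ (-(ε / 4)) * mMax F d.1 Y ≤ (mflat F d : ℝ)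

/-- CORNER data: `m♭ < X^{−ε/4}·m_max` — the Hall regime `|Δ♭| ≪ M⁺` together with data whose
`F`-value is carried by ramified / content primes. -/
def Corner : Region := fun ε X Y F d =>
  (mflat F d : ℝ) < X ^ (-(ε / 4)) * mMax F d.1 Y

/-- The three regions cover every datum. -/
theorem fewDeep_or_spread_or_corner (ε X Y : ℝ) (F : Form) (d : Datum) :
    FewDeep ε X Y F d ∨ Spread ε X Y F d ∨ Corner ε X Y F d := by
  by_cases hfloor : X ^ (-(ε / 4)) * mMax F d.1 Y ≤ (mflat F d : ℝ)
  · rcases le_or_gt (repRad (mflat F d) : ℝ) (wCap F d.1 X Y) with h | h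
    · exact Or.inl ⟨h, hfloor⟩
    · exact Or.inr (Or.inl ⟨h, hfloor⟩)
  · exact Or.inr (Or.inr (lt_of_not_ge hfloor))

/-! ### The conic lever's objects (over `O = RingOfForm F`, basis `1, ω, θ`) -/

open Classical in
/-- `|Cl(O)[2]|` for the maximal order `O = R(F)` of an irreducible form (a domain:
`isDomain_of_isIrreducible`); `1` for reducible forms (there the relevant 2-torsion is `≪ Disc^ε`
by genus theory and is absorbed in constants/`X^ε`). Bounded ON AVERAGE over cubic fields
ordered by discriminant: Bhargava 2005, Thm 5 (`5/4`, `3/2`). -/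
def twoTorsionCard (F : Form) : ℕ :=
  if h : F.IsIrreducible then
    (haveI : IsDomain (RingOfForm F) := isDomain_of_isIrreducible h
     Nat.card {c : ClassGroup (RingOfForm F) // c ^ 2 = 1})
  else 1

/-- The element `a·u + v·ω ∈ ℤ ⊕ ℤω = ker(z-coordinate) ⊂ O` attached to `(u, v)`; its norm is
`a²·F(u, v)` (checked), so divisibility of `F(u,v)` by squares is divisibility of this principal
ideal by squares of ideals. -/
def planeElt (F : Form) (u v : ℤ) : RingOfForm F := ⟨F.a * u, v, 0⟩

/-- **PLANARITY FACTORISATION** (the lever, per irreducible maximal form): there are a constant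
`C = C(F)` and finite SHAPE SETS `Λ T ⊂ O` (`T ≥ 1`) with `#Λ T ≤ C·|Cl(O)[2]|·3^{ω(T)}` and
`|N λ| ≤ C·T` on `Λ T`, such that for every coprime `(u, v)` with `F(u,v) ≠ 0`, writing `T` for the
square-free kernel and `S` for the square part of `m♭ = (|F(u,v)|` prime to `6·a·Disc F)`, one has
`r²·(a u + vω) = λ·β²` for some `λ ∈ Λ T`, `β ∈ O` with `S ∣ |N β|`, and `1 ≤ r ≤ C`.
(Proof route, size L: transport to `𝓞 K` (`nonempty_ringEquiv_ringOfIntegers_of_overring`);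
for `p ∤ 6a·Disc F` exactly one prime of `O` above `p` contains `a u + vω` and it has degree one,
so `(a u + vω) = 𝔞𝔟²𝔠` with `N𝔞 = T`, `S ∣ N𝔟`, `𝔠` over `6a·Disc F` (re-split into square-free and
square parts); `[𝔞𝔠'][𝔟']² = 1` puts `[𝔟']` in a coset of `Cl[2]`; fixed integral representatives
`𝔯` of the classes (`r = N𝔯`, Minkowski) give `𝔟'𝔯 = (β)`; generators are fixed modulo `O^{×2}`
(`|O^×/O^{×2}| ≤ 8`, Dirichlet).  Then `β` is a zero of the PLANARITY CONIC
`Q_λ(β) = z-coordinate(λβ²)`, an integral ternary quadratic form of determinant `a·N(λ)`.) -/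
def PlanarityFactorisation : Prop :=
  ∀ F : Form, F.IsIrreducible → IsMaximal F →
    ∃ (C : ℕ) (Λ : ℕ → Finset (RingOfForm F)), 0 < C ∧
      (∀ T : ℕ, ((Λ T).card : ℝ) ≤ C * twoTorsionCard F * 3 ^ T.primeFactors.card) ∧
      (∀ T : ℕ, ∀ l ∈ Λ T, ((Algebra.norm ℤ l).natAbs : ℝ) ≤ C * T) ∧
      ∀ u v : ℤ, IsCoprime u v → F.eval u v ≠ 0 →
        ∃ l ∈ Λ (sqfreeKernel (coprimePart (6 * F.a.natAbs * F.disc.natAbs) (F.eval u v).natAbs)),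
          ∃ β : RingOfForm F, ∃ r : ℕ, 1 ≤ r ∧ r ≤ C ∧
            ((r : RingOfForm F) ^ 2) * planeElt F u v = l * β ^ 2 ∧
            sqPart (coprimePart (6 * F.a.natAbs * F.disc.natAbs) (F.eval u v).natAbs) ∣
              (Algebra.norm ℤ β).natAbs

/-! ### The stub STATEMENTS (named `Prop`s; the registered `stub_*` theorems below prove exactly these,
and `Registered.stub_*` are their name-keyed aliases used as the hypotheses of `SharpModerateLaw_of`, as
the native skeleton audit admits hypotheses BY NAME — same device as
`Cruxes/MazurKaneLaw/Lines/fibre-toolkit-lp-wall-map.lean`; the audit's `stub` attribute itself is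
gate-reserved) -/

/-- Statement of STUB 1: the transfer `C⁺ → crux`. -/
def CuspTransfer : Prop :=
  CuspWindowLaw → Summit.ABC.ABC.Theses.TwistAmplification.SharpModerateLaw

/-- Statement of STUB 2: the Delone–Faddeev dictionary `index-form law (all data) → C⁺`. -/
def IndexFormDictionary : Prop :=
  IndexFormLaw univRegion → CuspWindowLaw

/-- Statement of STUB 3: the law on the few-deep population (Kane's lattice half over all maximal
cubic rings and twists). -/
def FewDeepLaw : Prop :=
  IndexFormLaw FewDeep

/-- Statement of STUB 5: the law on the spread population, GIVEN the planarity factorisation (the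
conic census — open core). -/
def SpreadCensus : Prop :=
  PlanarityFactorisation → IndexFormLaw Spread

/-- Statement of STUB 6: the law on the Hall / bad-prime corner (open; shared hard corner). -/
def CornerLaw : Prop :=
  IndexFormLaw Corner

/-! ### The registered stubs -/

/-- STUB 1 (M–L, provable now) — TRANSFER `C⁺ → SharpModerateLaw`; the registered signature is the
name `CuspTransfer`, which unfolds (`Iff.rfl`) to `CuspWindowLaw → SharpModerateLaw` (stated through
the name so that only `SharpModerateLaw_of` concludes the crux literally, as the skeleton audit takes
the first such theorem).  Given `3 < κ < 6 < σ`, `ε > 0`: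
a reduced minimal model `W₀` in the window maps to `x = (c₄, c₆)`; at most `12` models share `x`
(`a₁, a₃ ∈ {0,1}`, `a₂ ∈ {−1,0,1}` determine `a₄, a₆` from `c₄, c₆`); `x ∈ cuspWin X' Yⱼ` for the
dyadic `Yⱼ ∋ M⁺` and `X' = min(X, Yⱼ^{1/κ})`: `c₄c₆ ≠ 0` given, `c₄³ ≠ c₆²` from `IsElliptic`,
`1728 ∣ c₄³ − c₆²` (`WeierstrassCurve.c_relation`), `TF` from minimality at `p ≥ 5` (rescale
`y² = x³ − 27c₄x − 54c₆`) and at `2, 3` (`λ = 4, 9`; TRIAGE r1-3 checked), `N* ≤ N` by Tate/Ogg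
(`conductorExponent_eq_one_of_dvd_Δ_of_not_dvd_c₄`, additive ⟹ `f_p ≥ 2`), and `N* ≤ N ≤ M⁺^{1/κ}`.
`CuspWindowLaw σ' ε'` with `σ' = σ`, `ε' = ε/2` at `(X', Yⱼ)` (`Yⱼ ≤ X'^σ` since `σ > κ`): for
`Yⱼ ≤ X^κ` the bound `C X'^{ε'}(X'Yⱼ^{−1/6} + 1) = O(C X^{ε/2}(Yⱼ^{1/κ−1/6} + 1))` sums geometrically
(`κ < 6`) to `O(X^{1−κ/6+ε/2})`; for `X^κ < Yⱼ ≤ X^σ` it is `≤ C X^{ε/2}(X^{1−κ/6} + 1)` over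
`O(σ log X)` ranges.  Honours `κ<6`, `0<ε`, `c₄≠0`, `c₆≠0`, minimality (see module doc).  Leans on:
`window_finite`-type finiteness (cdisprove), `Set.ncard_le_ncard_of_injOn`-style counting, Mathlib
`WeierstrassCurve.c₄/c₆/Δ`, the tree's `Conductor` files. Why it might need reshaping: only if
`TF` at `2, 3` is not exactly implied by minimality (then weaken `TF` and re-derive the `g`-clauses
of `ifWin` — the law tolerates any BOUNDED `2,3`-content). -/
theorem stub_cuspTransfer : CuspTransfer := by
  sorry

/-- STUB 2 (L, provable now) — THE DICTIONARY `IndexFormLaw univRegion → CuspWindowLaw`.  Map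
`x = (c₄, c₆) ∈ cuspWin X Y` to `(F, (g, u, v))`: `F` = a fixed representative of the `GL₂(ℤ)`-class
of a maximal overring of `R(1, 0, −3c₄, −2c₆)` (`exists_isMaximal_overring`; class unique by
`gl2zEquiv_of_isMaximal_overrings`), `ξ ↦ t₀ + yω + zθ` under the embedding, `(y, z) = g·(u, v)`
with `(u, v)` coprime.  The map is injective (`(F, y, z)` recovers `(c₄, c₆) = (H/9, G/54)` by the
checked characteristic-polynomial identity) and lands in `ifWin F X Y`: `F(u,v) ≠ 0` and the index
`[O : ℤ[ξ]] = g³|F(u,v)|` (`det_toMatrix_one_self_sq`) give `2⁸3⁶Δ = Disc F·F(y,z)²`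
(`disc_eq_detOnQuot_sq_mul`, `syzygy_normal_form`), so `mplusIF = M⁺` exactly; `hess, cov ≠ 0` from
`c₄c₆ ≠ 0`; `TF ⟹` the `g`-clauses (`p² ∣ g ⟹ p⁴ ∣ c₄ ∧ p⁶ ∣ c₆`; `2⁴ ∣ g ⟹ 2⁸ ∣ c₄ ∧ 2¹¹ ∣ c₆`;
`3⁴ ∣ g ⟹ 3⁶ ∣ c₄ ∧ 3⁹ ∣ c₆`); `Nflat ≤ N*` prime by prime (`p ∣ g, p ∤ 6 ⟹ p ∣ c₄ ∧ p ∣ Δ`;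
`p ∤ 6g, p ∣ Disc F·F(u,v) ⟹ p ∣ Δ`).  Finitely many classes occur at fixed `(X, Y)`
(`cuspWin` finite), so they form an admissible `𝓕` and `#cuspWin X Y ≤ Σ_{F∈𝓕} #ifWin F X Y`;
apply the hypothesis with region `univRegion` and the same `(σ, ε)`.  Leans on: the tree's
`DeloneFaddeev*`, `SubringForms`, `MaximalOverring`, `Ideator1Sketch.syzygy_normal_form` (to
re-prove inline), Mathlib `Cubic`. -/
theorem stub_indexFormDictionary :
    IndexFormLaw univRegion → CuspWindowLaw := by
  sorry

/-- STUB 3 (L–XL, provable modulo two printed counting facts) — THE LATTICE HALF: the law on the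
FEW-DEEP population.  Per `(F, g)` with `w = wCap F g X Y ≥ 1` (else the region is empty since
`repRad ≥ 1`): fix the repeated radical `v ≤ w` and the powerful part `e` of `m♭` (`≪ Y^{ε/8}`
values of `e` given `v`, Kane Prop. 5); the budget `Nflat ≤ X` gives
`rad_{6g·Disc F}(F(u,v)) ≤ B := X/(g♭²·rad_{6g} Disc F)`, hence `e ≥ m♭·v/B ≥ X^{−ε/4} m_max v/B`
(the floor); `(u, v)` lies in one of `≤ 3^{ω(e)}` sublattices of index `e` (simple Hensel roots at
`p ∤ 6·Disc F`, root at infinity when `p ∣ a`); the seed region `{mplusIF F (g·) ≤ Y}` lies in an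
ellipse of area `≪ Y^{1/3}/(g²|Disc F|^{1/2})` (all roots of `t³ − 3c₄t − 2c₆` are
`≪ max(|c₄|^{1/2}, |c₆|^{1/3})`, covolume of the trace-zero projection of `O` is `≍ |Disc F|^{1/2}`),
and Kane's Lemma 4 gives `O(area/e + 1)` primitive points per sublattice.  Total per `(F, g)`:
`≪ X^{ε/2}(X^{1+ε/4}Y^{−1/6}/(g·rad Disc F) + w)`, and `Σ_{F,g} (g·rad₆ Disc F)^{−1} ≪ X^{ε/4}`
over ALL maximal rings with `|Disc| ≤ 2⁸3⁶Y` and tower-free `g` (`Disc F = d_k f²`, `#{F} ≤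
3^{ω(f)+1}·#Cl(k)[3]` by Hasse/CFT — to VENDOR; `Σ_{|d_k|≤Z} #Cl(k)[3] ≪ Z` = tree fact
`Literature.NumberTheory.QuadraticFields.bst_threeTorsion_mean`, Davenport–Heilbronn 1971 Thm 3).
Identical in content to the companion card's `LatticeHalf` + its `(K, g)`-sum (TRIAGE r1-1/2/3:
sound, provable; size L).  Why it might need reshaping: the floor/cap constants (`ε/4`, `2⁸3⁶`) are
this plan's choice; any `X^{o(ε)}`-equivalent choice works. -/
theorem stub_fewDeepPrimes : IndexFormLaw FewDeep := by
  sorry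

/-- STUB 4 (L, provable now) — THE LEVER: planarity factorisation in maximal cubic orders (see the
docstring of `PlanarityFactorisation` for the statement and the proof route).  Pure algebraic
number theory over `RingOfForm F ≅ 𝓞 K_F`; no analysis.  This is where Bhargava's averaged input
is PREPARED (the multiplicity is exactly `|Cl(O)[2]|`) but not used. -/
theorem stub_planarityFactorisation : PlanarityFactorisation := by
  sorry

/-- STUB 5 (XL⁺, OPEN — the line's TARGET, HARDEST) — THE SPREAD CENSUS: given the planarity
factorisation, the law holds on the SPREAD population `v(m♭) > w` above the floor.  How the line
means to prove it (Kane Prop. 9 transplanted + a census, see the line card §Hardest): a spread datum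
of `(F, g)` with `m♭ = T·S²`, `S ≥ v > w`, `T ≤ B/v`, is by STUB 4 a primitive zero `β` of the
planarity conic `Q_λ`, `λ ∈ Λ T` (`det Q_λ = a·Nλ ≍ T`), in a region of side-product `≍ S`; the
SHARP conic bound (exponent `1/3`: Heath-Brown 2002 Cor. 2 / Browning–Le Boudec; the tree's
`SquarefulDet.fiberBound` is its diagonal case — NOT Kane's Thm 7 with exponent `1/2`, which
overcharges the `T ≍ 1` cells by `R^{1/4}`) bounds the zeros per conic by
`≪ (1 + (S/T)^{1/3}) (aT)^ε`; so the spread count is `≪ X^ε Σ_{F,g} Σ_{cells (T,S)} Σ_{hit (λ)}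
(1 + (S/T)^{1/3})` and the CENSUS proper is: jointly over rings `F` (four coefficients of
averaging), twists `g`, cells and shapes, the hit conics are `≪ X^{ε}·(X Y^{−1/6} + 1)` in number
AND the excess `(S/T)^{1/3}` over data is paid only where `S ≤ B/T` (all conic points admissible);
the residual cells `S > B/T` need a radical-sensitive count of conic points (`rad Nβ ≤ B/T`) — a
genuinely new input, recorded as the first open question of the line.  The only new multiplicity,
`|Cl(O)[2]|`, is summed with Bhargava 2005 Thm 5 (bounded mean over ALL cubic fields; for the thin
families `Disc = d_k f²`, `f` large, it is an assumption — card caveat (c)).  Why plausibly true: it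
is implied by the crux (the region is a sub-population and the law is the `(c₄, c₆)` random model,
refuter review #2 on the item); why it might fail as a PROGRAMME: the census saving must be a full
power (`Y^{5/6}/X` at `Y > X^{6/5}`), i.e. an equidistribution statement for planarity conics of
skew cubic rings in the cusp, beyond every variance method (TRIAGE r1-3 barrier note BN1). -/
theorem stub_spreadCensus : PlanarityFactorisation → IndexFormLaw Spread := by
  sorry

/-- STUB 6 (XL, OPEN, not attacked by this line's lever) — THE CORNER LAW: the law on data with
`m♭ < X^{−ε/4}·m_max`, i.e. the Hall regime `|Δ♭| ≤ X^{−ε/2}·(max |Δ| at this M⁺)` (integer points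
within `M⁺^{1/2}X^{−ε/2}` of the cusp `c₄³ = c₆²`, with conductor budget) plus data whose `F`-value
is carried by ramified or content primes.  This is the "one hard corner, five names" of TRIAGE r1-2
(card 3 item 7, card 4 item 5, card 5 item 6, card 6's `z = 1` slice, card 7's `(θ*, 3]`):
self-similar, of full exponent for `κ ≥ 15/4`, below the `√`-barrier of every one-variable method.
Why plausibly true: implied by the crux; Hall–Danilov families sit ON the law (HallExponentSharp
respected: nothing asserts `|x³ − y²| ≫ x^{1/2+}`).  A lead may hand it to the line that owns the
corner (cusp-dispersion / 3-descent cluster) — it is typed here so that the composition is honest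
about the crux's full range. -/
theorem stub_cornerLaw : IndexFormLaw Corner := by
  sorry

/-! ### Consistency: each named statement IS its registered stub (definitionally) -/

theorem cuspTransfer_holds : CuspTransfer := stub_cuspTransfer
theorem indexFormDictionary_holds : IndexFormDictionary := stub_indexFormDictionary
theorem fewDeepLaw_holds : FewDeepLaw := stub_fewDeepPrimes
theorem planarityFactorisation_holds : PlanarityFactorisation := stub_planarityFactorisation
theorem spreadCensus_holds : SpreadCensus := stub_spreadCensus
theorem cornerLaw_holds : CornerLaw := stub_cornerLaw

/-! ### Name-keyed aliases of the six statements (the hypotheses of the composition) -/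
namespace Registered

/-- Alias of `CuspTransfer` keyed by the registered stub name. -/
abbrev stub_cuspTransfer : Prop := CuspTransfer
/-- Alias of `IndexFormDictionary` keyed by the registered stub name. -/
abbrev stub_indexFormDictionary : Prop := IndexFormDictionary
/-- Alias of `FewDeepLaw` keyed by the registered stub name. -/
abbrev stub_fewDeepPrimes : Prop := FewDeepLaw
/-- Alias of `PlanarityFactorisation` keyed by the registered stub name. -/
abbrev stub_planarityFactorisation : Prop := PlanarityFactorisation
/-- Alias of `SpreadCensus` keyed by the registered stub name. -/
abbrev stub_spreadCensus : Prop := SpreadCensus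
/-- Alias of `CornerLaw` keyed by the registered stub name. -/
abbrev stub_cornerLaw : Prop := CornerLaw

end Registered

/-! ### Glue (proved): laws on covering regions give the law everywhere -/

/-- Restricting a window to a larger region does not decrease the count, at the level of the
defining sets: the `univRegion` slice is the union of the three population slices. -/
theorem slice_univ_eq_union (ε X Y : ℝ) (F : Form) :
    {d ∈ ifWin F X Y | univRegion ε X Y F d} =
      ({d ∈ ifWin F X Y | FewDeep ε X Y F d} ∪ {d ∈ ifWin F X Y | Spread ε X Y F d}) ∪
        {d ∈ ifWin F X Y | Corner ε X Y F d} := by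
  ext d
  simp only [univRegion, Set.mem_setOf_eq, and_true, Set.mem_union]
  constructor
  · intro hd
    rcases fewDeep_or_spread_or_corner ε X Y F d with h | h | h
    · exact Or.inl (Or.inl ⟨hd, h⟩)
    · exact Or.inl (Or.inr ⟨hd, h⟩)
    · exact Or.inr ⟨hd, h⟩
  · rintro ((⟨hd, -⟩ | ⟨hd, -⟩) | ⟨hd, -⟩) <;> exact hd

/-- Sub-additivity of the sliced counts under the three-way cover (no finiteness needed:
`Set.ncard_union_le`). -/
theorem ncard_slice_univ_le (ε X Y : ℝ) (F : Form) :
    (Set.ncard {d ∈ ifWin F X Y | univRegion ε X Y F d} : ℝ) ≤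
      (Set.ncard {d ∈ ifWin F X Y | FewDeep ε X Y F d} : ℝ) +
        (Set.ncard {d ∈ ifWin F X Y | Spread ε X Y F d} : ℝ) +
          (Set.ncard {d ∈ ifWin F X Y | Corner ε X Y F d} : ℝ) := by
  rw [slice_univ_eq_union]
  have h₁ := Set.ncard_union_le
    ({d ∈ ifWin F X Y | FewDeep ε X Y F d} ∪ {d ∈ ifWin F X Y | Spread ε X Y F d})
    {d ∈ ifWin F X Y | Corner ε X Y F d}
  have h₂ := Set.ncard_union_le {d ∈ ifWin F X Y | FewDeep ε X Y F d}
    {d ∈ ifWin F X Y | Spread ε X Y F d}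
  exact_mod_cast h₁.trans (Nat.add_le_add_right h₂ _)

/-- **Glue.** The law on the few-deep, spread and corner populations gives the law on all data
(constants add). -/
theorem indexFormLaw_univ_of_cover (h₁ : IndexFormLaw FewDeep) (h₂ : IndexFormLaw Spread)
    (h₃ : IndexFormLaw Corner) : IndexFormLaw univRegion := by
  intro σ ε hε
  obtain ⟨C₁, hC₁⟩ := h₁ σ ε hε
  obtain ⟨C₂, hC₂⟩ := h₂ σ ε hε
  obtain ⟨C₃, hC₃⟩ := h₃ σ ε hε
  refine ⟨C₁ + C₂ + C₃, fun X Y hX hY hYX 𝓕 h𝓕 hpw => ?_⟩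
  have e₁ := hC₁ X Y hX hY hYX 𝓕 h𝓕 hpw
  have e₂ := hC₂ X Y hX hY hYX 𝓕 h𝓕 hpw
  have e₃ := hC₃ X Y hX hY hYX 𝓕 h𝓕 hpw
  calc ∑ F ∈ 𝓕, (Set.ncard {d ∈ ifWin F X Y | univRegion ε X Y F d} : ℝ)
      ≤ ∑ F ∈ 𝓕, ((Set.ncard {d ∈ ifWin F X Y | FewDeep ε X Y F d} : ℝ) +
          (Set.ncard {d ∈ ifWin F X Y | Spread ε X Y F d} : ℝ) +
            (Set.ncard {d ∈ ifWin F X Y | Corner ε X Y F d} : ℝ)) :=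
        Finset.sum_le_sum fun F _ => ncard_slice_univ_le ε X Y F
    _ = ∑ F ∈ 𝓕, (Set.ncard {d ∈ ifWin F X Y | FewDeep ε X Y F d} : ℝ) +
          ∑ F ∈ 𝓕, (Set.ncard {d ∈ ifWin F X Y | Spread ε X Y F d} : ℝ) +
            ∑ F ∈ 𝓕, (Set.ncard {d ∈ ifWin F X Y | Corner ε X Y F d} : ℝ) := by
        rw [Finset.sum_add_distrib, Finset.sum_add_distrib]
    _ ≤ C₁ * X ^ ε * (X * Y ^ (-(1 / 6 : ℝ)) + 1) + C₂ * X ^ ε * (X * Y ^ (-(1 / 6 : ℝ)) + 1) +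
          C₃ * X ^ ε * (X * Y ^ (-(1 / 6 : ℝ)) + 1) := add_le_add (add_le_add e₁ e₂) e₃
    _ = (C₁ + C₂ + C₃) * X ^ ε * (X * Y ^ (-(1 / 6 : ℝ)) + 1) := by ring

/-! ### The composition: the six stubs imply the crux, by name -/

/-- `SharpModerateLaw` from the six stubs (pure logic; no `sorry`): STUB 4 feeds STUB 5 (spread law),
which with STUB 3 (few-deep law) and STUB 6 (corner law) glues to the index-form law on all data;
STUB 2 turns it into the cusp law C⁺ and STUB 1 into the crux. -/
theorem SharpModerateLaw_of (h1 : Registered.stub_cuspTransfer)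
    (h2 : Registered.stub_indexFormDictionary) (h3 : Registered.stub_fewDeepPrimes)
    (h4 : Registered.stub_planarityFactorisation) (h5 : Registered.stub_spreadCensus)
    (h6 : Registered.stub_cornerLaw) :
    Summit.ABC.ABC.Theses.TwistAmplification.SharpModerateLaw :=
  h1 (h2 (indexFormLaw_univ_of_cover h3 (h5 h4) h6))

/-- Wiring check: the registered stubs feed `SharpModerateLaw_of` as stated. -/
example : Summit.ABC.ABC.Theses.TwistAmplification.SharpModerateLaw :=
  SharpModerateLaw_of stub_cuspTransfer stub_indexFormDictionary stub_fewDeepPrimes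
    stub_planarityFactorisation stub_spreadCensus stub_cornerLaw

end Summit.ABC.ABC.Cruxes.SharpModerateLaw.UnitPlaneConicTwoTorsion

end
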